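import Literature.AlgebraicGeometry.Limits.LocalizationProperSpreadOfGenericFibre
import Literature.AlgebraicGeometry.Limits.SubalgebraDiagram
import Literature.AlgebraicGeometry.Limits.StageRestriction
import HarnessLib

/-!
# Properness over a RELATIVE base `P` spreads from the generic stage `P_B` to a finite stage `P_s`
# (EGA IV₃ 8.10.5 (xii) / The Stacks Project, Tag 081F, in the relative form with `P → Spec A` proper)

Topic `Literature/AlgebraicGeometry/Limits`, namespace `Literature.AlgebraicGeometry.Limits.LocApprox`.  THEOREMS ONLY (no definition,
no named fact, no instance, no notation, no `sorry`).  Sequel of ★ `Limits/LocalizationProperSpreadOfGenericFibre` (the ABSOLUTE form: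
properness of the generic fibre `Q ×_A Spec K → Spec K` of a qc∕qs∕l.f.p. `A`-scheme `Q` spreads to `Q ×_A Spec A[1∕s] → Spec A[1∕s]`,
`A` a Noetherian domain, `K = Frac A`) in the ★ `LocApprox` currency of ★ `Limits/LocalizationDiagram` (`Idx S`, `baseDiagram S`,
`baseCone S B`) and ★ `Limits/LocalizationProdLimit` (the stages `P ⊗ (baseDiagram S).obj t` of an `A`-scheme `P`).

Cell `hodgecm-mathlib` (D-0151), FLOOR 0, P6 «MOD programme» (crux hLiu418 = stmt-HodgeConjecture-24832), SPREAD door of `stub_RGD` (LEAD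
F0P6-plan M-17m∕M-17q), organ (α) (SP1) «ABELIAN-SCHEME SPREAD OVER A LocApprox STAGE», A-p06 (g31)'s census
`F0/P6/A-p06/g31/CENSUS-SP1-AbelianSchemeSpreadStage.A-p06g31.md` §3 **(c)** (LEAD 20:42:56Z cut; B-p18 (g37)).  Consumer: (e)
`AbelianSchemes/AbelianSchemeOverSpreadStage.exists_stage_of_generic` (A-p06).  HC_CM is proved only modulo the printed citations until rung 0
closes; nothing here is about HC.

THE MATHEMATICS.  `A` a Noetherian domain, `B = Frac A` presented as a localisation `A_S` (`IsLocalization S B`, `IsFractionRing A B`),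
`P → Spec A` PROPER (and qc∕qs), `t : Idx S`, `Y → P_t := P ⊗ D(t)` qc∕qs∕l.f.p. whose base change `Y ×_{P_t} P_B → P_B` to the
generic stage `P_B := P ⊗ Spec B` is PROPER.  Then for some finer stage `s → t` the base change `Y ×_{P_t} P_s → P_s` is proper.  Proof
(«the total space as an `A`-scheme», A-p06's KEY REDUCTION): `Q := (Y → P_t → Spec A)` is a qc∕qs∕l.f.p. `A`-scheme; since
`P_B = P_t ×_{D(t)} Spec B` (★ `SubalgApprox.isPullback_whiskerLeft_left`) and `D(t) ↪ Spec A` is a monomorphism, the generic fibre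
`Q ×_A Spec B` is `Y ×_{P_t} P_B`, proper over `Spec B` because `P_B → Spec B` is; ★ `exists_forall_isProper_snd` gives `s₀ ≠ 0` with
`Q ×_A Spec A[1∕u] → Spec A[1∕u]` proper for every non-zero-divisor multiple `u` of `s₀`; `S⁻¹A = Frac A` supplies `m ∈ S` with
`s₀ ∣ m` (`exists_mem_dvd_of_isUnit`), and at the stage `s := t·m` one reads `Q ×_A D(s) = Y ×_{P_t} P_s` (same two squares), so
`Y ×_{P_t} P_s → D(s)` is proper, whence `Y ×_{P_t} P_s → P_s` is proper by cancellation against the separated `P_s → D(s)`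
(Mathlib `IsProper.of_comp`).  No Chow lemma beyond the absolute ★ file; WITHOUT `[IsProper P.hom]` the statement is EGA IV₃ 8.10.5 (xii)
in full relative form and is not claimed here.

* §1 `exists_mem_dvd_of_isUnit` — in a localisation `A_S`, an element of `A` that becomes a unit divides an element of `S`;
  `mem_nonZeroDivisors_of_mem` — `S ⊆` non-zero-divisors when `A_S` is a field of fractions of the domain `A`.
* §2 `isPullback_fst_snd_comp_snd` — the square `Y ×_{P_t} P_{T′} → T′` over `Y → D(t)` for any `g : T′ → D(t)` over `A` (two ★ squares
  pasted), and `isPullback_fst_snd_comp_snd_hom` — the same over `Spec A` (`D(t) ↪ Spec A` mono).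
* §3 **`exists_stage_isProper`** — the theorem above, A-p06's memo §3 (c) signature verbatim (`Y : Over (P ⊗ D(t)).left`, Mathlib
  `pullback.snd` currency = the output of ★ (a) `exists_stage_isPullback`).
* §4 the same in the «MODEL OVER THE STAGE» currency of ★ (a) `LocalizationRelativeSchemeSpread` §2∕§4 and ★ `StageRestriction`
  (`Y : SchemeOver A`, `h : Y ⊗ D(t) ⟶ P ⊗ D(t)` over `D(t)`, restrictions `res ρ h`): **`exists_stage_le_isProper_snd`** (the absolute ★
  spread re-indexed into `Idx S` below a given stage) and **`exists_stage_isProper_res`** (`(res ρ h).left` proper at a finer stage as soon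
  as the generic value `hB : Y ⊗ Spec B ⟶ P ⊗ Spec B` has `hB.left` proper — no compatibility between `h` and `hB` is needed for this).

## References
* [EGAIV3] A. Grothendieck, J. Dieudonné, EGA IV₃ (Publ. Math. IHÉS 28, 1966), Thm. 8.10.5 (xii).
* [StacksProject] The Stacks Project, Tag 081F (properness descends through a limit), Tag 01W6 (`f` proper if `g ∘ f` proper and `g` separated).
* [GortzWedhorn2020] U. Görtz, T. Wedhorn, *Algebraic Geometry I*, 2nd ed. (2020), Section (4.7) (pp. 107–108) (base change).
* [AtiyahMacdonald1969] M. F. Atiyah, I. G. Macdonald, *Introduction to Commutative Algebra* (1969), Ch. 3 (pp. 36–44: rings of fractions, saturation).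
-/

set_option autoImplicit false

noncomputable section

universe u

open CategoryTheory CategoryTheory.Limits AlgebraicGeometry MonoidalCategory CartesianMonoidalCategory

namespace Literature.AlgebraicGeometry.Limits

namespace LocApprox

open Literature.AlgebraicGeometry.Motives (SchemeOver specOver)

/-! ## §1 Two facts about the index set `S` when `A_S` is the field of fractions -/

section Algebra

variable {A : Type u} [CommRing A] (S : Submonoid A) (B : Type u) [CommRing B] [Algebra A B] [IsLocalization S B]

/-- **An element of `A` that becomes a unit in `A_S` divides an element of `S`**: if `a⁻¹ = b∕m` then `c·m = a·(c·b)` for some `c ∈ S`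
(Mathlib `IsLocalization.surj`, `IsLocalization.eq_iff_exists`) — `a` lies in the saturation of `S`. [cite: AtiyahMacdonald1969, Ch. 3, Exercise 7 (p. 44)] -/
theorem exists_mem_dvd_of_isUnit {a : A} (ha : IsUnit (algebraMap A B a)) : ∃ m ∈ S, a ∣ m := by
  obtain ⟨z, hz⟩ := ha.exists_right_inv
  obtain ⟨⟨b, m⟩, hbm⟩ := IsLocalization.surj S z
  -- `algebraMap m = algebraMap (a * b)`
  have h1 : algebraMap A B (m : A) = algebraMap A B (a * b) := by
    have h2 : z * algebraMap A B (m : A) = algebraMap A B b := hbm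
    calc algebraMap A B (m : A) = (algebraMap A B a * z) * algebraMap A B (m : A) := by rw [hz, one_mul]
      _ = algebraMap A B a * algebraMap A B b := by rw [mul_assoc, h2]
      _ = algebraMap A B (a * b) := by rw [map_mul]
  obtain ⟨c, hc⟩ := (IsLocalization.eq_iff_exists S B).mp h1
  exact ⟨(c : A) * (m : A), S.mul_mem c.2 m.2, ⟨(c : A) * b, by rw [hc]; ring⟩⟩

/-- **`S` consists of non-zero-divisors** when `A` is a domain and `A_S` is nontrivial (its elements become units, so are non-zero;
`S⁻¹A = 0 ⇔ 0 ∈ S`). [cite: AtiyahMacdonald1969, Ch. 3 (p. 37)] -/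
theorem mem_nonZeroDivisors_of_mem [IsDomain A] [Nontrivial B] {m : A} (hm : m ∈ S) : m ∈ nonZeroDivisors A := by
  refine mem_nonZeroDivisors_of_ne_zero fun h0 => ?_
  subst h0
  have hu : IsUnit (algebraMap A B 0) := IsLocalization.map_units B ⟨0, hm⟩
  rw [map_zero, isUnit_zero_iff] at hu
  exact zero_ne_one hu

end Algebra

/-! ## §2 The base-change squares of a `P_t`-scheme along `T′ → D(t)` and over `Spec A` -/

section Squares

variable {A : Type u} [CommRing A] (P : SchemeOver A) {D T' : SchemeOver A} (g : T' ⟶ D) (Y : Over (P ⊗ D).left)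

/-- **`Y ×_{P ⊗ D} (P ⊗ T′) → T′` is the base change of `Y → D` along `g : T′ → D`**: the square of `Y ⊗_{P ⊗ D} (P ⊗ T′)` over `Y` and
`P ⊗ T′ → T′` over `P ⊗ D → D` (Mathlib `IsPullback.of_hasPullback` pasted with ★ `SubalgApprox.isPullback_whiskerLeft_left`).
[cite: GortzWedhorn2020, Section (4.7) (pp. 107–108)] -/
theorem isPullback_fst_snd_comp_snd :
    IsPullback (pullback.fst Y.hom (P ◁ g).left) (pullback.snd Y.hom (P ◁ g).left ≫ pullback.snd P.hom T'.hom)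
      (Y.hom ≫ pullback.snd P.hom D.hom) g.left :=
  (IsPullback.of_hasPullback Y.hom (P ◁ g).left).paste_vert (SubalgApprox.isPullback_whiskerLeft_left P g)

/-- **… and over `Spec A` when `D → Spec A` is a monomorphism** (e.g. `D = D(t)` a basic open): `Y ×_{P ⊗ D} (P ⊗ T′)` is the base change of
the `A`-scheme `Y → P ⊗ D → Spec A` along `T′ → Spec A` (Mathlib `IsPullback.of_vert_isIso_mono` for the square `T′ = T′ ×_{Spec A} D`).
[cite: GortzWedhorn2020, Section (4.7) (pp. 107–108)] -/
theorem isPullback_fst_snd_comp_snd_hom [Mono D.hom] :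
    IsPullback (pullback.fst Y.hom (P ◁ g).left) (pullback.snd Y.hom (P ◁ g).left ≫ pullback.snd P.hom T'.hom)
      (Y.hom ≫ (P ⊗ D).hom) T'.hom := by
  have hsq : IsPullback g.left (𝟙 T'.left) D.hom T'.hom :=
    IsPullback.of_vert_isIso_mono ⟨by rw [Category.id_comp, Over.w g]⟩
  have h := (isPullback_fst_snd_comp_snd P g Y).paste_vert hsq
  rw [Category.comp_id, Category.assoc] at h
  have hD : (P ⊗ D).hom = pullback.snd P.hom D.hom ≫ D.hom := by
    rw [Over.tensorObj_hom, pullback.condition]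
  have hY : Y.hom ≫ (P ⊗ D).hom = Y.hom ≫ pullback.snd P.hom D.hom ≫ D.hom := congrArg (Y.hom ≫ ·) hD
  rw [hY]
  exact h

end Squares

/-! ## §3 Properness spreads from `P_B` to a stage `P_s` -/

section Proper

variable {A : Type u} [CommRing A] {S : Submonoid A} {B : Type u} [CommRing B] [Algebra A B] [IsLocalization S B]
  (P : SchemeOver A) [QuasiCompact P.hom] [QuasiSeparated P.hom]

/-- **PROPERNESS OVER `P` SPREADS FROM THE GENERIC STAGE TO A FINITE STAGE** ([EGAIV3] 8.10.5 (xii), [StacksProject] 081F, relative form with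
`P → Spec A` proper): `A` a Noetherian domain, `B = Frac A = A_S`, `P → Spec A` proper (qc∕qs; no `LocallyOfFinitePresentation P.hom` needed), `Y → P ⊗ D(t)` qc∕qs∕l.f.p. with
`Y ×_{P_t} P_B → P_B` proper; then `Y ×_{P_t} P_s → P_s` is proper for some stage `s → t`.  Route: the total space `Q := (Y → Spec A)`,
§2 to read its fibres over `Spec B` and `D(s)` as `Y ×_{P_t} P_B`, `Y ×_{P_t} P_s`, the absolute ★ `exists_forall_isProper_snd` (with
§1 to land IN `S`), and cancellation of the separated `P_s → D(s)` (Mathlib `IsProper.of_comp`). [cite: EGAIV3, Thm. 8.10.5 (xii)]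
[cite: StacksProject, Tag 081F] -/
theorem exists_stage_isProper [IsDomain A] [IsNoetherianRing A] [IsFractionRing A B] [IsProper P.hom] {t : Idx S}
    (Y : Over (P ⊗ (baseDiagram S).obj t).left) [QuasiCompact Y.hom] [QuasiSeparated Y.hom] [LocallyOfFinitePresentation Y.hom]
    (h : IsProper (pullback.snd Y.hom (P ◁ (baseCone S B).π.app t).left)) :
    ∃ (s : Idx S) (ρ : s ⟶ t), IsProper (pullback.snd Y.hom (P ◁ (baseDiagram S).map ρ).left) := by
  haveI : Nontrivial B := (IsFractionRing.injective A B).nontrivial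
  letI : Field B := IsFractionRing.toField A
  -- the total space `Q := (Y → P_t → Spec A)`, a qc/qs/l.f.p. `A`-scheme
  let Q : SchemeOver A := Over.mk (Y.hom ≫ (P ⊗ (baseDiagram S).obj t).hom)
  haveI : QuasiCompact Q.hom := by change QuasiCompact (Y.hom ≫ _); infer_instance
  haveI : QuasiSeparated Q.hom := by change QuasiSeparated (Y.hom ≫ _); infer_instance
  haveI : LocallyOfFinitePresentation Q.hom := by change LocallyOfFinitePresentation (Y.hom ≫ _); infer_instance
  -- its generic fibre is `Y ×_{P_t} P_B → Spec B`, proper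
  have hB := isPullback_fst_snd_comp_snd_hom P ((baseCone S B).π.app t) Y
  have hcomp : IsProper (pullback.snd Y.hom (P ◁ (baseCone S B).π.app t).left ≫ pullback.snd P.hom (specOver A B).hom) :=
    MorphismProperty.comp_mem @IsProper _ _ h (MorphismProperty.pullback_snd (P := @IsProper) _ _ inferInstance)
  have hgen : IsProper (pullback.snd Q.hom (Spec.map (CommRingCat.ofHom (algebraMap A B)))) := by
    have e : hB.isoPullback.hom ≫ pullback.snd Q.hom (Spec.map (CommRingCat.ofHom (algebraMap A B))) =
        pullback.snd Y.hom (P ◁ (baseCone S B).π.app t).left ≫ pullback.snd P.hom (specOver A B).hom :=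
      hB.isoPullback_hom_snd
    have key : IsProper (hB.isoPullback.hom ≫ pullback.snd Q.hom (Spec.map (CommRingCat.ofHom (algebraMap A B)))) := by
      rw [e]; exact hcomp
    exact (MorphismProperty.cancel_left_of_respectsIso @IsProper _ _).mp key
  -- the absolute spread on `Q`
  obtain ⟨s₀, hs₀, H⟩ := exists_forall_isProper_snd B Q hgen
  -- land in `S`: `s₀ ∣ m ∈ S`, stage `s := t·m`
  have hu : IsUnit (algebraMap A B s₀) := IsUnit.mk0 _ (IsFractionRing.to_map_ne_zero_of_mem_nonZeroDivisors hs₀)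
  obtain ⟨m, hmS, hsm⟩ := exists_mem_dvd_of_isUnit S B hu
  let s : Idx S := ⟨t.val * m, S.mul_mem t.mem hmS⟩
  have hst : s ≤ t := Idx.le_iff.mpr (dvd_mul_right _ _)
  refine ⟨s, homOfLE hst, ?_⟩
  -- `Q ×_A D(s) → D(s)` is proper
  have hQs : IsProper (pullback.snd Q.hom ((baseDiagram S).obj s).hom) :=
    H s.val (mem_nonZeroDivisors_of_mem S B s.mem) (dvd_trans hsm (dvd_mul_left _ _)) (loc S s)
  -- read it as `Y ×_{P_t} P_s → D(s)` and cancel the separated `P_s → D(s)`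
  have hS' := isPullback_fst_snd_comp_snd_hom P ((baseDiagram S).map (homOfLE hst)) Y
  let g₁ : pullback Y.hom (P ◁ (baseDiagram S).map (homOfLE hst)).left ⟶ (P ⊗ (baseDiagram S).obj s).left :=
    pullback.snd Y.hom (P ◁ (baseDiagram S).map (homOfLE hst)).left
  let g₂ : (P ⊗ (baseDiagram S).obj s).left ⟶ ((baseDiagram S).obj s).left := pullback.snd P.hom ((baseDiagram S).obj s).hom
  have e : hS'.isoPullback.hom ≫ pullback.snd Q.hom ((baseDiagram S).obj s).hom = g₁ ≫ g₂ := hS'.isoPullback_hom_snd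
  haveI : IsProper (g₁ ≫ g₂) := by
    rw [← e]
    exact (MorphismProperty.cancel_left_of_respectsIso @IsProper _ _).mpr hQs
  haveI : IsSeparated g₂ := MorphismProperty.pullback_snd (P := @IsSeparated) _ _ inferInstance
  exact IsProper.of_comp g₁ g₂

/-! ## §4 The same in the «model over the stage» currency (`Y : SchemeOver A`, `h : Y ⊗ D(t) ⟶ P ⊗ D(t)`, `res ρ h`) -/

omit [QuasiCompact P.hom] [QuasiSeparated P.hom] in
/-- **The absolute ★ spread, re-indexed into `Idx S` below a given stage**: `A` a Noetherian domain, `B = Frac A = A_S`, `Y → Spec A`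
qc∕qs∕l.f.p. with proper generic fibre `Y ×_A Spec B → Spec B`; then for every `t : Idx S` there is a finer stage `s → t` with
`Y ×_A D(s) → D(s)` proper (★ `exists_forall_isProper_snd` + §1 to land in `S`). [cite: EGAIV3, Thm. 8.10.5 (xii)] [cite: StacksProject, Tag 081F] -/
theorem exists_stage_le_isProper_snd [IsDomain A] [IsNoetherianRing A] [IsFractionRing A B]
    (Y : SchemeOver A) [QuasiCompact Y.hom] [QuasiSeparated Y.hom] [LocallyOfFinitePresentation Y.hom]
    (hY : IsProper (pullback.snd Y.hom (specOver A B).hom)) (t : Idx S) :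
    ∃ (s : Idx S) (_ : s ⟶ t), IsProper (pullback.snd Y.hom ((baseDiagram S).obj s).hom) := by
  haveI : Nontrivial B := (IsFractionRing.injective A B).nontrivial
  letI : Field B := IsFractionRing.toField A
  obtain ⟨s₀, hs₀, H⟩ := exists_forall_isProper_snd B Y hY
  have hu : IsUnit (algebraMap A B s₀) := IsUnit.mk0 _ (IsFractionRing.to_map_ne_zero_of_mem_nonZeroDivisors hs₀)
  obtain ⟨m, hmS, hsm⟩ := exists_mem_dvd_of_isUnit S B hu
  let s : Idx S := ⟨t.val * m, S.mul_mem t.mem hmS⟩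
  have hst : s ≤ t := Idx.le_iff.mpr (dvd_mul_right _ _)
  exact ⟨s, homOfLE hst, H s.val (mem_nonZeroDivisors_of_mem S B s.mem) (dvd_trans hsm (dvd_mul_left _ _)) (loc S s)⟩

omit [QuasiCompact P.hom] [QuasiSeparated P.hom] in
/-- **PROPERNESS OVER `P` SPREADS — «MODEL OVER THE STAGE» FORM**: `A` a Noetherian domain, `B = Frac A = A_S`, `P → Spec A` proper, `Y → Spec A`
qc∕qs∕l.f.p. with a model `h : Y ⊗ D(t) ⟶ P ⊗ D(t)` over `D(t)` and a generic value `hB : Y ⊗ Spec B ⟶ P ⊗ Spec B` over `Spec B` with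
`hB.left` PROPER (no compatibility of `h` with `hB` is used): then `(res ρ h).left : (Y ⊗ D(s)).left ⟶ (P ⊗ D(s)).left` is proper for some
`ρ : s ⟶ t` — `Y ⊗ Spec B → Spec B` is `hB ≫ snd`, proper; `exists_stage_le_isProper_snd`; `res ρ h ≫ snd = snd` (★ `res_snd`) and
cancellation of the separated `(P ⊗ D(s)).left → D(s)` (Mathlib `IsProper.of_comp`). [cite: EGAIV3, Thm. 8.10.5 (xii)] [cite: StacksProject, Tag 081F] -/
theorem exists_stage_isProper_res [IsDomain A] [IsNoetherianRing A] [IsFractionRing A B] [IsProper P.hom]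
    {Y : SchemeOver A} [QuasiCompact Y.hom] [QuasiSeparated Y.hom] [LocallyOfFinitePresentation Y.hom] {t : Idx S}
    (h : Y ⊗ (baseDiagram S).obj t ⟶ P ⊗ (baseDiagram S).obj t)
    (hB : Y ⊗ specOver A B ⟶ P ⊗ specOver A B) (hhB : hB ≫ snd _ _ = snd _ _) (hprop : IsProper hB.left) :
    ∃ (s : Idx S) (ρ : s ⟶ t), IsProper (res ρ h).left := by
  -- the generic fibre `Y ⊗ Spec B → Spec B` is `hB ≫ snd`, proper
  have hgen : IsProper (pullback.snd Y.hom (specOver A B).hom) := by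
    have e : (snd Y (specOver A B)).left = hB.left ≫ (snd P (specOver A B)).left := by
      rw [← Over.comp_left, hhB]
    have e' : pullback.snd Y.hom (specOver A B).hom = hB.left ≫ pullback.snd P.hom (specOver A B).hom := e
    rw [e']
    exact MorphismProperty.comp_mem @IsProper _ _ hprop (MorphismProperty.pullback_snd (P := @IsProper) _ _ inferInstance)
  obtain ⟨s, ρ, hs⟩ := exists_stage_le_isProper_snd (B := B) Y hgen t
  refine ⟨s, ρ, ?_⟩
  let g₁ : (Y ⊗ (baseDiagram S).obj s).left ⟶ (P ⊗ (baseDiagram S).obj s).left := (res ρ h).left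
  let g₂ : (P ⊗ (baseDiagram S).obj s).left ⟶ ((baseDiagram S).obj s).left := (snd P ((baseDiagram S).obj s)).left
  have e : g₁ ≫ g₂ = pullback.snd Y.hom ((baseDiagram S).obj s).hom := by
    change (res ρ h).left ≫ (snd P ((baseDiagram S).obj s)).left = (snd Y ((baseDiagram S).obj s)).left
    rw [← Over.comp_left, res_snd]
  haveI : IsProper (g₁ ≫ g₂) := by rw [e]; exact hs
  haveI : IsSeparated g₂ := MorphismProperty.pullback_snd (P := @IsSeparated) _ _ inferInstance
  exact IsProper.of_comp g₁ g₂

end Proper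

end LocApprox

end Literature.AlgebraicGeometry.Limits

end
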